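import Summits.NavierStokesRegularity.NavierStokesRegularity.Theses.SwirlThreshold

/-!
# `Assembly` — rank-1 assembly of route SwirlThreshold

Item stmt-NavierStokesRegularity-1154 (assembly). Pure logic: the curried form
`AxisymBlowup → ClayUniqueness → ¬ NavierStokesRegularity` of the accepted glue
`Literature.NS.certifiedBlowup_assembly_v2` (route CertifiedBlowup, item
stmt-NavierStokesRegularity-0726), whose hypothesis is the conjunction of the two verbatim
bodies. No analysis; both hypotheses are open items of the route.
-/

-- the summit and its single problem share the name (D-0017 nested layout)
set_option linter.dupNamespace false

namespace Summit.NavierStokesRegularity.NavierStokesRegularity.Theorems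

/-- **Assembly** (item stmt-NavierStokesRegularity-1154): an axisymmetric finite-time blow-up
witness (the body of `AxisymBlowup`, stmt-NavierStokesRegularity-0727) together with Clay-class
uniqueness (the body of `ClayUniqueness`, stmt-NavierStokesRegularity-0153) refutes Clay
statement (A), `NavierStokesRegularity`. Proof: uncurry and apply
`Literature.NS.certifiedBlowup_assembly_v2`. [folklore] -/
theorem swirlThreshold_assembly_proof :
    Summit.NavierStokesRegularity.NavierStokesRegularity.Theses.SwirlThreshold.Assembly := by
  unfold Summit.NavierStokesRegularity.NavierStokesRegularity.Theses.SwirlThreshold.Assembly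
  intro hBlowup hUniq
  exact Literature.NS.certifiedBlowup_assembly_v2 ⟨hBlowup, hUniq⟩

end Summit.NavierStokesRegularity.NavierStokesRegularity.Theorems
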